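import Literature.NumberTheory.Automorphic.Liu2021.LemD1AsPrintedIndexedNonVacuityEpsAlone
import Literature.NumberTheory.Automorphic.Liu2021.LemD1AsPrintedIndexedNonVacuityInertFrobenius
import HarnessLib

/-!
# [Liu2021, App. D Lemma D.1 (1) ∧ (3)] AS PRINTED with the `μ`-conjunct ALONE separating at INERT TAME places of ANY quadratic
# `E/F`: the carrier character `Ψ = θ ∘ det` from ANY global norm-one unit `ζ` with `v_w(ζ^N − 1) < v_w(ζ − 1)`, and the inert case
# `gcd(N, q_v + 1) > 1`

Reproduction ∕ bookkeeping (Literature, THEOREMS ONLY: no definition, no record, no named fact, no `sorry`; nothing is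
asserted about Liu's oscillator representations or about the tree's constructed local Weil carriers).

Sequel of `…DetCarrier.lean` (split places), `…TorsionCarrier.lean` (`ζ_m ∈ E`), `…WildCarrier.lean` (`w ∣ N`) and of
`…InertFrobenius.lean` (the Frobenius congruence `c • u ≡ u^{q_v} (mod 𝔭_w)` at an inert place and the inert torsion witness
`ζ = u / c(u)` with `v_w(ζ − 1) = 1`, `v_w(ζ^N − 1) < 1` whenever `gcd(N, q_v + 1) > 1`).

* §1 **`exists_carrier_character_of_norm_one`** — the COMMON GENERALISATION of the torsion carrier (✔ `…TorsionCarrier.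
  exists_torsion_carrier_character`: `ζ^N = 1`, `v_w(ζ − 1) = 1`) and the wild carrier (✔ `…WildCarrier.exists_wild_carrier_character`:
  a principal unit above a prime dividing `N`): at a NON-SPLIT place `w` (`c • w = w`) of the place model of [Liu2021, App. D §D.1]
  over ANY quadratic `E/F`, ANY `N ≥ 2`, every GLOBAL `ζ ∈ E` with `ζ · c(ζ) = 1`, `v_w(ζ − 1) ≠ 0` and `v_w(ζ^N − 1) < v_w(ζ − 1) =: γ`
  yields a character `Ψ = θ ∘ det` of `U(V)(F_v) = S.U` with `Ψ ∘ S.scalar = 1` (`det(z · 1_N) = z^N`, `θ^N = 1`), `Ψ = 1` on the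
  open neighbourhood `{g : v_w(det(g)_w − 1) < γ}` of `1`, `Ψ(g₀) ≠ 1` for some `g₀` (`det : U(V)(F_v) → E_v¹` is ONTO,
  ✔ `…DetCarrier.exists_mem_U_det_eq`), all values `N`-th roots of unity — by ✔ `…WildCarrier.exists_character_pow_eq_one_of_level`
  (the finite group `𝒪_wˣ ∕ U_γ` and the non-injective `N`-th power map on the image of `E_v¹`).
* §2 **`exists_inert_carrier_character`** — at an INERT place (`v` unramified in `E`, `c • w = w`) with `N` NOT coprime to
  `q_v + 1`: the carrier from the inert torsion witness of ✔ `…InertFrobenius.exists_norm_one_inert_witness_of_not_coprime` (`γ = 1`: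
  `Ψ` is trivial on `{g : v_w(det(g)_w − 1) < 1}`).  NO torsion in `E`, NO `w ∣ N` needed: the remaining TAME non-split case named by
  ✔ p403274 ∕ p403693 («governed by `gcd(N, |κ_w¹|)` at inert `w`»; `|κ_w¹| = q_v + 1`).
* §3 the JOINT certificate «(1) ∧ (3)» with the `μ`-CONJUNCT ALONE separating, from ANY centre-trivial character (copy of the
  siblings' private family construction) — **`exists_lemD1IndexedFamily_item1_and_lemD1_3_mu_of_norm_one`** (general `ζ`, non-split
  `w`), **`exists_lemD1IndexedFamily_item1_and_lemD1_3_mu_of_inert`** (inert `w`, `gcd(N, q_v + 1) > 1`), and the hypothesis-free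
  consequences **`not_forall_mu_eq_of_sameClass_of_chi_eq_of_inert`**, **`not_forall_areIsomorphicRep_of_chi_eq_of_inert`**
  (every `N ≥ 3`; `MuSet S` non-empty at every place, ✔ `…NormClassExtensionDyadic.nonempty_muSet`).
* §4 the CM rows (`L` CM, `F = L⁺`, member `0` = the rows' own `μ_v = localMu L (toHeckeCharacter L ψ) v`):
  `exists_lemD1IndexedFamily_item1_and_lemD1_3_localMu_mu_of_inert`, `not_forall_mu_eq_of_sameClass_of_chi_eq_of_isCMField_of_inert`,
  `not_forall_areIsomorphicRep_of_chi_eq_of_isCMField_of_inert`; THE END's CASE `3 ∣ N`: every inert place `v` of `L⁺` (unramified in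
  `L`) with `q_v ≡ 2 (mod 3)` — `…_of_isCMField_of_three_dvd`.

Picture for an auditor of the END rows `hD1''` ∕ `hD3` (our bookkeeping, not a claim about Liu's objects): for the END's rank `N = 3` and
ANY CM field `L` (with or without `ζ_3`), the `μ`-conjunct of [Lem. D.1 (3)] AS PRINTED is now certified to separate two members with
EQUAL `ε`-class and EQUAL `χ` by a det-line carrier at: every split place (✔ DetCarrier), every place above `3` (✔ WildCarrier), and every
inert place `v ∤ 𝔡_{L/L⁺}` with `q_v ≡ 2 (mod 3)` (this file); at inert `v` with `q_v ≡ 1 (mod 3)`, `v ∤ 3`, NO det-line carrier exists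
(`E_w¹ = (E_w¹)³` there — not formalised), and ramified non-split places are not treated.

What this does NOT give: the `ε`-alone analogue at inert places (the private family of ✔ `…EpsAlone` would serve verbatim); the converse
at inert places with `gcd(N, q_v(q_v + 1)) = 1`; ramified non-split places; anything about the rows' OWN carriers `𝓢.omegaLoc v`;
Lem. D.1 itself.  HC_CM is NOT proved.

Cell pub-hodgecm2 (COR-CM), audit class of the END rows `hD1''` ∕ `hD3`; seat prover-pub-hodgecm2-b10.

References: [Liu2021] Y. Liu, *Fourier–Jacobi cycles and arithmetic relative trace formula*, Camb. J. Math. 9 (2021) =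
arXiv:2102.11518, App. D §D.1 (l. 5213–5221), Lemma D.1 (1) (l. 5229), (3) (l. 5233), Def. 4.11 (l. 2086); [Mok2014] C. P. Mok,
Mem. AMS 235 (2015), §1 Notation p. 5; [NeukirchANT1999] J. Neukirch, *Algebraic Number Theory* (1999), Ch. I §9 Exercise 2 (Frobenius),
Ch. II §3 Prop. (3.10) (`U^{(n)}`, `𝒪^*/U^{(n)}` finite), Ch. II §5 Prop. (5.3); [CasselsFrohlichANT1967] Ch. II §10, Ch. VII §1.1.
-/

noncomputable section

open scoped Matrix MatrixGroups
open NumberField IsDedekindDomain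
open Literature.RepresentationTheory
open Literature.RepresentationTheory.Liu2021 (OscillatorStandingData)
open Literature.RepresentationTheory.CentralCharacterQuotient (augmentation quotRep quotRep_mk)
open Literature.NumberTheory.GaloisRepresentations (HeckeCharacter)

namespace Literature.NumberTheory.Automorphic.Liu2021.LemD1IndexedNonVacuityInertCarrier

open UnitaryGroup

/-! ## §1 The carrier character `Ψ = θ ∘ det` at a NON-SPLIT place from ANY global norm-one unit `ζ` with `v_w(ζ^N − 1) < v_w(ζ − 1)` -/

section PlaceModel

variable {F : Type} (E : Type) [Field F] [NumberField F] [Field E] [NumberField E] [Algebra F E]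
  [Algebra.IsQuadraticExtension F E] (v : HeightOneSpectrum (𝓞 F)) (c : E ≃ₐ[F] E)
  {δ : E} (hcδ : c δ = -δ) (hδ : δ ≠ 0)
  (N : ℕ) (J : Matrix (Fin N) (Fin N) E) (hN : 2 ≤ N) (hJh : (J.map c)ᵀ = J) (hJdet : J.det ≠ 0)

omit [NumberField F] [Algebra.IsQuadraticExtension F E] in
include hcδ hδ in
/-- `c ≠ 1` (`c δ = −δ ≠ δ`); copy of the siblings' private lemma. [folklore] -/
private theorem hc_of_delta : c ≠ 1 := by
  rintro rfl
  rw [AlgEquiv.one_apply] at hcδ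
  have h2 : (2 : E) * δ = 0 := by linear_combination hcδ
  exact hδ ((mul_eq_zero.mp h2).resolve_left two_ne_zero)

omit [Algebra F E] in
/-- the «level set» `{y : v_w(y − 1) < v_w(t)}` is open in `E_w` (copy of the sibling's private lemma).
[cite: NeukirchANT1999, Ch. II §3, before Prop. (3.10)] -/
private theorem isOpen_setOf_valued_sub_one_lt (w : HeightOneSpectrum (𝓞 E)) (t : w.adicCompletion E) :
    IsOpen {y : w.adicCompletion E | Valued.v (y - 1) < Valued.v t} := by
  have h := (Valued.isOpen_ball (w.adicCompletion E) (Valued.v.restrict t)).preimage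
    (show Continuous fun y : w.adicCompletion E => y - 1 from continuous_id.sub continuous_const)
  convert h using 1
  ext y
  simp only [Set.mem_setOf_eq, Set.mem_preimage, Valuation.restrict_lt_iff]

include hcδ hδ in
/-- at a NON-SPLIT place `w` (`c • w = w`), norm-one elements are `w`-units (`v_w(z_w)² = 1`); copy of the siblings' private lemma.
[cite: CasselsFrohlichANT1967, Ch. VII §1.1] -/
private theorem valued_apply_eq_one_of_mem_normOne (w : PlacesOver E v) (hw : c • w.1 = w.1)
    (z : (LemD1OfPlace.standingData E v c N J hcδ hδ hN hJh hJdet).normOne) :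
    Valued.v ((((z : (LocalRing E v)ˣ) : LocalRing E v)) w) = 1 := by
  have h := LemD1IndexedNonVacuityInertRigidity.valued_mul_conjLocal_apply E v c hcδ hδ w hw ((z : (LocalRing E v)ˣ) : LocalRing E v)
  rw [LemD1OfPlace.mul_conjLocal_eq_one E v c N J hcδ hδ hN hJh hJdet z, Pi.one_apply, map_one] at h
  exact (pow_eq_one_iff_left two_ne_zero).1 h.symm

/-- determinants of `U(V)(F_v)` are norm-one (`(gᶜ)ᵀ (J ⊗ 1) g = J ⊗ 1`, `det (J ⊗ 1)` a unit); copy of the siblings' private lemma.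
[cite: Liu2021, App. D §D.1 (l. 5213)] [cite: Mok2014, §1 Notation p. 5] -/
private theorem det_mem_normOne (g : (LemD1OfPlace.standingData E v c N J hcδ hδ hN hJh hJdet).U) :
    Matrix.GeneralLinearGroup.det (g : GL (Fin N) (LocalRing E v)) ∈ (LemD1OfPlace.standingData E v c N J hcδ hδ hN hJh hJdet).normOne := by
  let S := LemD1OfPlace.standingData E v c N J hcδ hδ hN hJh hJdet
  rw [OscillatorStandingData.mem_normOne_iff', Matrix.GeneralLinearGroup.val_det_apply]
  have hg := (OscillatorStandingData.mem_U_iff S _).1 g.2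
  have h := congrArg Matrix.det hg
  rw [Matrix.det_mul, Matrix.det_mul, Matrix.det_transpose] at h
  have hc : (((g : GL (Fin N) (LocalRing E v)) : Matrix (Fin N) (Fin N) (LocalRing E v)).map S.conj).det =
      S.conj (((g : GL (Fin N) (LocalRing E v)) : Matrix (Fin N) (Fin N) (LocalRing E v)).det) := by
    rw [AlgEquiv.map_det, AlgEquiv.mapMatrix_apply]
  rw [hc] at h
  have h2 : (((g : GL (Fin N) (LocalRing E v)) : Matrix (Fin N) (Fin N) (LocalRing E v)).det *
      S.conj (((g : GL (Fin N) (LocalRing E v)) : Matrix (Fin N) (Fin N) (LocalRing E v)).det) - 1) * S.gram.det = 0 := by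
    linear_combination h
  exact sub_eq_zero.1 ((S.isUnit_det_gram.mul_left_eq_zero).1 h2)

include hcδ in
/-- **THE CARRIER CHARACTER FROM A GLOBAL NORM-ONE UNIT** — the common generalisation of the torsion carrier (`ζ^N = 1`,
`v_w(ζ − 1) = 1`) and the wild carrier (a principal unit above a prime dividing `N`): at a NON-SPLIT place `w` (`c • w = w`), for
ANY `N ≥ 2` and any `ζ ∈ E` with `ζ · c(ζ) = 1`, `v_w(ζ − 1) ≠ 0` and `v_w(ζ^N − 1) < v_w(ζ − 1) =: γ`, there is a character
`Ψ = θ ∘ det` of `U(V)(F_v) = S.U` (`θ` a character of the image of `E_v¹` in `E_wˣ` with `θ^N = 1`, `θ = 1` on `{v_w(x − 1) < γ}`,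
`θ ≠ 1`, ✔ `…WildCarrier.exists_character_pow_eq_one_of_level`) with `Ψ ∘ S.scalar = 1` (`det(z · 1_N) = z^N`), `Ψ = 1` on the open
neighbourhood `{g : v_w(det(g)_w − 1) < γ}` of `1`, `Ψ(g₀) ≠ 1` for some `g₀` (`det` is ONTO `E_v¹`, ✔ `…DetCarrier.exists_mem_U_det_eq`),
all values `N`-th roots of unity. [cite: Liu2021, App. D §D.1 Step 3 (l. 5221)] [cite: Mok2014, §1 Notation p. 5]
[cite: NeukirchANT1999, Ch. II §3 Prop. (3.10)] -/
theorem exists_carrier_character_of_norm_one (w : PlacesOver E v) (hw : c • w.1 = w.1) (ζ : E) (hζc : ζ * c ζ = 1)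
    (hζ0 : w.1.valuation E (ζ - 1) ≠ 0) (hζN : w.1.valuation E (ζ ^ N - 1) < w.1.valuation E (ζ - 1)) :
    ∃ Ψ : (LemD1OfPlace.standingData E v c N J hcδ hδ hN hJh hJdet).U →* ℂˣ,
      (∀ z : (LemD1OfPlace.standingData E v c N J hcδ hδ hN hJh hJdet).normOne,
        Ψ ((LemD1OfPlace.standingData E v c N J hcδ hδ hN hJh hJdet).scalar z) = 1) ∧
      (∃ O : Set (LemD1OfPlace.standingData E v c N J hcδ hδ hN hJh hJdet).U, IsOpen O ∧ 1 ∈ O ∧ ∀ g ∈ O, Ψ g = 1) ∧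
      (∃ g₀ : (LemD1OfPlace.standingData E v c N J hcδ hδ hN hJh hJdet).U, Ψ g₀ ≠ 1) ∧
      (∀ g, Ψ g ^ N = 1) ∧ (∀ g, ‖((Ψ g : ℂˣ) : ℂ)‖ = 1) := by
  have hN0 : N ≠ 0 := by omega
  let S := LemD1OfPlace.standingData E v c N J hcδ hδ hN hJh hJdet
  let prw : (LocalRing E v)ˣ →* (w.1.adicCompletion E)ˣ :=
    Units.map (Pi.evalRingHom (fun w' : PlacesOver E v => w'.1.adicCompletion E) w).toMonoidHom
  have hprw : ∀ y : (LocalRing E v)ˣ, ((prw y : (w.1.adicCompletion E)ˣ) : w.1.adicCompletion E) = (y : LocalRing E v) w :=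
    fun y => rfl
  -- the image `A` of `E_v¹` in `E_wˣ`: `w`-units
  let A : Subgroup (w.1.adicCompletion E)ˣ := S.normOne.map prw
  have hA : ∀ x ∈ A, Valued.v ((x : (w.1.adicCompletion E)ˣ) : w.1.adicCompletion E) = 1 := by
    rintro x ⟨z, hz, rfl⟩
    rw [hprw]
    exact valued_apply_eq_one_of_mem_normOne E v c hcδ hδ N J hN hJh hJdet w hw ⟨z, hz⟩
  -- the global norm-one unit `ι(ζ) ∈ E_v¹`
  have hu : IsUnit (algebraMap E (LocalRing E v) ζ) :=
    IsUnit.of_mul_eq_one (algebraMap E (LocalRing E v) (c ζ)) (by rw [← map_mul, hζc, map_one])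
  have hzn : hu.unit ∈ S.normOne := by
    rw [OscillatorStandingData.mem_normOne_iff', LemD1OfPlace.standingData_conj_apply, IsUnit.unit_spec, conjLocal_algebraMap,
      ← map_mul, hζc, map_one]
  have hζA : prw hu.unit ∈ A := Subgroup.mem_map_of_mem prw hzn
  have hcoe : ((prw hu.unit : (w.1.adicCompletion E)ˣ) : w.1.adicCompletion E) = ((ζ : E) : w.1.adicCompletion E) := by
    rw [hprw, IsUnit.unit_spec]; rfl
  have hval : Valued.v (((prw hu.unit : (w.1.adicCompletion E)ˣ) : w.1.adicCompletion E) - 1) = w.1.valuation E (ζ - 1) := by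
    rw [hcoe]
    have : ((ζ : E) : w.1.adicCompletion E) - 1 = ((ζ - 1 : E) : w.1.adicCompletion E) := by
      change algebraMap E (w.1.adicCompletion E) ζ - 1 = algebraMap E (w.1.adicCompletion E) (ζ - 1)
      rw [map_sub, map_one]
    rw [this, HeightOneSpectrum.valuedAdicCompletion_eq_valuation']
  have hvalN : Valued.v ((((prw hu.unit) ^ N : (w.1.adicCompletion E)ˣ) : w.1.adicCompletion E) - 1) =
      w.1.valuation E (ζ ^ N - 1) := by
    rw [Units.val_pow_eq_pow_val, hcoe]
    have : ((ζ : E) : w.1.adicCompletion E) ^ N - 1 = ((ζ ^ N - 1 : E) : w.1.adicCompletion E) := by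
      change algebraMap E (w.1.adicCompletion E) ζ ^ N - 1 = algebraMap E (w.1.adicCompletion E) (ζ ^ N - 1)
      rw [map_sub, map_pow, map_one]
    rw [this, HeightOneSpectrum.valuedAdicCompletion_eq_valuation']
  have hζ0' : Valued.v (((prw hu.unit : (w.1.adicCompletion E)ˣ) : w.1.adicCompletion E) - 1) ≠ 0 := by rw [hval]; exact hζ0
  have hζN' : Valued.v ((((prw hu.unit) ^ N : (w.1.adicCompletion E)ˣ) : w.1.adicCompletion E) - 1) <
      Valued.v (((prw hu.unit : (w.1.adicCompletion E)ˣ) : w.1.adicCompletion E) - 1) := by rw [hvalN, hval]; exact hζN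
  obtain ⟨θ, hθN, hθnorm, hθ1, ⟨x₀, hx₀⟩⟩ :=
    LemD1IndexedNonVacuityWildCarrier.exists_character_pow_eq_one_of_level w.1 hN0 A hA hζA hζ0' hζN'
  -- `θ' = θ ∘ (E_v¹ → A)`, `detN : U(V)(F_v) → E_v¹`, `Ψ = θ' ∘ detN`
  let θ' : S.normOne →* ℂˣ := θ.comp (prw.subgroupMap S.normOne)
  have hθ' : ∀ z, θ' z = θ (prw.subgroupMap S.normOne z) := fun z => rfl
  let detN : S.U →* S.normOne :=
    (Matrix.GeneralLinearGroup.det.comp S.U.subtype).codRestrict S.normOne fun g => det_mem_normOne E v c hcδ hδ N J hN hJh hJdet g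
  have hdetN : ∀ g : S.U, ((detN g : S.normOne) : (LocalRing E v)ˣ) = Matrix.GeneralLinearGroup.det (g : GL (Fin N) (LocalRing E v)) :=
    fun g => rfl
  let Ψ : S.U →* ℂˣ := θ'.comp detN
  have hΨ : ∀ g, Ψ g = θ' (detN g) := fun g => rfl
  have hdet : ∀ z : S.normOne, detN (S.scalar z) = z ^ N := fun z => by
    apply Subtype.ext
    rw [hdetN, SubgroupClass.coe_pow]
    apply Units.ext
    rw [Matrix.GeneralLinearGroup.val_det_apply, OscillatorStandingData.coe_scalar, Matrix.scalar_apply, Matrix.det_diagonal,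
      Finset.prod_const, Finset.card_univ, Fintype.card_fin, Units.val_pow_eq_pow_val]
  refine ⟨Ψ, fun z => ?_, ?_, ?_, fun g => by rw [hΨ, hθ', hθN], fun g => by rw [hΨ, hθ', hθnorm]⟩
  · rw [hΨ, hdet, map_pow, hθ', hθN]
  · let f : S.U → w.1.adicCompletion E := fun g =>
      (((g : GL (Fin N) (LocalRing E v)) : Matrix (Fin N) (Fin N) (LocalRing E v)).map
        (Pi.evalRingHom (fun w' : PlacesOver E v => w'.1.adicCompletion E) w)).det
    have hf : ∀ g, f g = ((prw (Matrix.GeneralLinearGroup.det (g : GL (Fin N) (LocalRing E v))) :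
        (w.1.adicCompletion E)ˣ) : w.1.adicCompletion E) := fun g => by
      rw [hprw, Matrix.GeneralLinearGroup.val_det_apply]
      change _ = (Pi.evalRingHom (fun w' : PlacesOver E v => w'.1.adicCompletion E) w)
        (((g : GL (Fin N) (LocalRing E v)) : Matrix (Fin N) (Fin N) (LocalRing E v)).det)
      rw [RingHom.map_det]
      rfl
    have hfc : Continuous f := by
      refine Continuous.matrix_det ?_
      refine Continuous.matrix_map ?_ (continuous_apply w)
      exact Units.continuous_val.comp continuous_subtype_val
    refine ⟨f ⁻¹' {y | Valued.v (y - 1) < Valued.v (((prw hu.unit : (w.1.adicCompletion E)ˣ) : w.1.adicCompletion E) - 1)},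
      (isOpen_setOf_valued_sub_one_lt E w.1 _).preimage hfc, ?_, fun g hg => ?_⟩
    · rw [Set.mem_preimage, Set.mem_setOf_eq, hf, OneMemClass.coe_one, map_one, map_one, Units.val_one, sub_self, map_zero]
      exact zero_lt_iff.2 hζ0'
    · rw [Set.mem_preimage, Set.mem_setOf_eq, hf] at hg
      rw [hΨ, hθ']
      exact hθ1 _ hg
  · obtain ⟨z₀, rfl⟩ := MonoidHom.subgroupMap_surjective prw S.normOne x₀
    obtain ⟨g₀, hg₀⟩ := LemD1IndexedNonVacuityDetCarrier.exists_mem_U_det_eq E v c hcδ hδ N J hN hJh hJdet z₀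
    refine ⟨g₀, ?_⟩
    have hdg : detN g₀ = z₀ := Subtype.ext (by rw [hdetN, hg₀])
    rw [hΨ, hdg, hθ']
    exact hx₀

/-! ## §2 The INERT carrier: `v` unramified in `E`, `c • w = w`, `gcd(N, q_v + 1) > 1` -/

include hcδ in
/-- **THE INERT CARRIER CHARACTER** — at an INERT place (`v` unramified in `E`, `w ∣ v` with `c • w = w`) of ANY quadratic `E/F`,
for every `N ≥ 2` NOT coprime to `q_v + 1 = #κ(w)¹` (`q_v = #(𝓞_F ∕ 𝔭_v)`): a character `Ψ` of `U(V)(F_v)` trivial on the centre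
`S.scalar (E_v¹)`, trivial on the open neighbourhood `{g : v_w(det(g)_w − 1) < 1}` of `1`, non-trivial, with values `N`-th roots of unity —
§1 applied to the inert torsion witness `ζ = u / c(u)` of ✔ `…InertFrobenius.exists_norm_one_inert_witness_of_not_coprime`
(`v_w(ζ − 1) = 1`, `v_w(ζ^N − 1) < 1`; the class of `ζ` in `κ(w)ˣ` has prime order dividing `gcd(N, q_v + 1)`).  NO root of unity in
`E` and NO `w ∣ N` is needed. [cite: Liu2021, App. D §D.1 Step 3 (l. 5221)] [cite: NeukirchANT1999, Ch. I §9 Exercise 2 and Ch. II §3 Prop. (3.10)] -/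
theorem exists_inert_carrier_character (hv : Algebra.IsUnramifiedIn (𝓞 E) v.asIdeal) (w : PlacesOver E v) (hw : c • w.1 = w.1)
    (hNq : ¬ Nat.Coprime N (Nat.card (𝓞 F ⧸ v.asIdeal) + 1)) :
    ∃ Ψ : (LemD1OfPlace.standingData E v c N J hcδ hδ hN hJh hJdet).U →* ℂˣ,
      (∀ z : (LemD1OfPlace.standingData E v c N J hcδ hδ hN hJh hJdet).normOne,
        Ψ ((LemD1OfPlace.standingData E v c N J hcδ hδ hN hJh hJdet).scalar z) = 1) ∧
      (∃ O : Set (LemD1OfPlace.standingData E v c N J hcδ hδ hN hJh hJdet).U, IsOpen O ∧ 1 ∈ O ∧ ∀ g ∈ O, Ψ g = 1) ∧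
      (∃ g₀ : (LemD1OfPlace.standingData E v c N J hcδ hδ hN hJh hJdet).U, Ψ g₀ ≠ 1) ∧
      (∀ g, Ψ g ^ N = 1) ∧ (∀ g, ‖((Ψ g : ℂˣ) : ℂ)‖ = 1) := by
  obtain ⟨ζ, hζc, -, hζ1, hζN⟩ := LemD1IndexedNonVacuityInertFrobenius.exists_norm_one_inert_witness_of_not_coprime E c v
    (hc_of_delta E c hcδ hδ) hv w hw hNq
  exact exists_carrier_character_of_norm_one E v c hcδ hδ N J hN hJh hJdet w hw ζ hζc (by rw [hζ1]; exact one_ne_zero)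
    (by rw [hζ1]; exact hζN)

/-! ## §3 The JOINT certificate «(1) ∧ (3)» with the `μ`-conjunct ALONE separating -/

/-- For a datum whose carrier is the line `ℂ` with `U(V)(F)` acting through a character `λ` that agrees with `χ` on the centre,
the `χ`-augmentation submodule vanishes (copy of the siblings' private lemma). [folklore] -/
private theorem augmentation_eq_bot_of_character {F₀ E₀ : Type} [Field F₀] [ValuativeRel F₀] [TopologicalSpace F₀]
    [CommRing E₀] [Algebra F₀ E₀] [TopologicalSpace E₀] {n : ℕ} (L : LemD1Data F₀ E₀ n ℂ) (lam : L.S.U →* ℂˣ)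
    (hω : ∀ (g : L.S.U) (x : ℂ), L.omega g x = (lam g : ℂ) * x)
    (hcen : ∀ z : L.S.normOne, lam (L.S.scalar z) = L.chi z) :
    augmentation L.omega L.S.scalar L.chi = ⊥ := by
  unfold augmentation
  refine iSup_eq_bot.2 fun z => ?_
  rw [LinearMap.range_eq_bot]
  ext
  simp [hω, hcen]

/-- Two lines on which a group acts through characters `λ₁` and `λ₀` with `λ₁ g₀ ≠ λ₀ g₀` for some `g₀` have NON-isomorphic maximal
`χ`-quotients (the first quotient being the line itself).  Copy of the siblings' private lemma. [folklore] -/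
private theorem not_areIsomorphicRep_quotRep_of_characters {G Z : Type*} [Group G] [Group Z]
    (ρ₁ ρ₀ : Representation ℂ G ℂ) {ζ : Z →* G} (hζ : ∀ z, ζ z ∈ Subgroup.center G) (χ₁ χ₀ : Z →* ℂˣ)
    (lam₁ lam₀ : G →* ℂˣ) (h₁ : ∀ (g : G) (x : ℂ), ρ₁ g x = (lam₁ g : ℂ) * x) (h₀ : ∀ (g : G) (x : ℂ), ρ₀ g x = (lam₀ g : ℂ) * x)
    (hN₁ : augmentation ρ₁ ζ χ₁ = ⊥) {g₀ : G} (hg₀ : lam₁ g₀ ≠ lam₀ g₀) :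
    ¬ AreIsomorphicRep (quotRep ρ₁ hζ χ₁) (quotRep ρ₀ hζ χ₀) := by
  rintro ⟨f, hf⟩
  have hw0 : (Submodule.Quotient.mk 1 : ℂ ⧸ augmentation ρ₁ ζ χ₁) ≠ 0 := by
    rw [Ne, Submodule.Quotient.mk_eq_zero, hN₁, Submodule.mem_bot]
    exact one_ne_zero
  have h1 : quotRep ρ₁ hζ χ₁ g₀ (Submodule.Quotient.mk 1) =
      (lam₁ g₀ : ℂ) • (Submodule.Quotient.mk 1 : ℂ ⧸ augmentation ρ₁ ζ χ₁) := by
    rw [quotRep_mk, h₁, ← smul_eq_mul, Submodule.Quotient.mk_smul]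
  have h2 : ∀ y : ℂ ⧸ augmentation ρ₀ ζ χ₀, quotRep ρ₀ hζ χ₀ g₀ y = (lam₀ g₀ : ℂ) • y := by
    intro y
    obtain ⟨u, rfl⟩ := Submodule.Quotient.mk_surjective _ y
    rw [quotRep_mk, h₀, ← smul_eq_mul, Submodule.Quotient.mk_smul]
  have key := hf g₀ (Submodule.Quotient.mk 1)
  rw [h1, h2, map_smul] at key
  have hsub : ((lam₁ g₀ : ℂ) - lam₀ g₀) • f (Submodule.Quotient.mk 1) = 0 := by
    rw [sub_smul, key, sub_self]
  rcases smul_eq_zero.1 hsub with h | h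
  · exact hg₀ (Units.ext (sub_eq_zero.1 h))
  · exact hw0 (f.injective (by rw [h, map_zero]))

/-- **Item (1) AS PRINTED holds at a character datum of rank `n ≠ 2`** (copy of the siblings' private lemma).
[cite: Liu2021, App. D Lemma D.1 (1) (l. 5229)] -/
private theorem lemD1_1AsPrinted_of_character_of_rank_ne_two' {F₀ E₀ : Type} [Field F₀] [ValuativeRel F₀]
    [TopologicalSpace F₀] [CommRing E₀] [Algebra F₀ E₀] [TopologicalSpace E₀] [IsTopologicalRing E₀] {n₀ : ℕ}
    (L : LemD1Data F₀ E₀ n₀ ℂ) (lam : L.S.U →* ℂˣ) (hω : ∀ (g : L.S.U) (x : ℂ), L.omega g x = (lam g : ℂ) * x)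
    (hcen : ∀ z : L.S.normOne, lam (L.S.scalar z) = L.chi z)
    (hopen : ∃ O : Set L.S.U, IsOpen O ∧ (1 : L.S.U) ∈ O ∧ ∀ g ∈ O, lam g = 1) (hn : n₀ ≠ 2) :
    LemD1_1AsPrinted L := by
  have hN : augmentation L.omega L.S.scalar L.chi = ⊥ := augmentation_eq_bot_of_character L lam hω hcen
  have hfin : Module.finrank ℂ (ℂ ⧸ augmentation L.omega L.S.scalar L.chi) = 1 := by
    rw [(Submodule.quotEquivOfEqBot _ hN).finrank_eq, Module.finrank_self]
  haveI hsimple : IsSimpleModule ℂ (ℂ ⧸ augmentation L.omega L.S.scalar L.chi) :=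
    isSimpleModule_iff_finrank_eq_one.2 hfin
  have hact : ∀ (g : L.S.U) (w : ℂ ⧸ augmentation L.omega L.S.scalar L.chi),
      L.datum.quot g w = (lam g : ℂ) • w := by
    intro g w
    obtain ⟨y, rfl⟩ := Submodule.Quotient.mk_surjective _ w
    rw [LemD1Data.datum_quot, quotRep_mk, hω, ← smul_eq_mul, Submodule.Quotient.mk_smul]
  refine ⟨⟨?_, ?_, ?_⟩, ?_⟩
  · intro W
    rcases eq_bot_or_eq_top W.toSubmodule with h | h
    · exact Or.inl (Subrepresentation.toSubmodule_injective h)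
    · exact Or.inr (Subrepresentation.toSubmodule_injective h)
  · intro x
    obtain ⟨O, hO, h1O, hlam⟩ := hopen
    change IsOpen (L.datum.quot.stabilizerSubgroup x : Set L.S.U)
    refine Subgroup.isOpen_of_mem_nhds _ (g := 1) (Filter.mem_of_superset (hO.mem_nhds h1O) fun g hg => ?_)
    change L.datum.quot g x = x
    rw [hact, hlam g hg, Units.val_one, one_smul]
  · intro K _
    infer_instance
  · refine iff_of_false ?_ ?_
    · rw [not_subsingleton_iff_nontrivial]
      exact Module.nontrivial_of_finrank_pos (R := ℂ) (by rw [hfin]; exact one_pos)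
    · exact fun h => hn h.2.1.2

include hcδ in
/-- **the `μ`-alone family from ANY character of `U(V)(F_v)` trivial on the centre, with open kernel neighbourhood and a non-trivial value**:
labels `(μ, e, 1)`, `(μ', e, 1)` (`μ'` the level twist, `μ'(ε) = −μ(ε)`), carriers the trivial line and the line of `Ψ`; (1) member by member,
(3) for all four pairs, only the `μ`-conjunct failing, the `ω`'s non-isomorphic (copy of the siblings' private construction).
[cite: Liu2021, App. D Lemma D.1 (1) and (3) (l. 5229, 5233)] -/
private theorem exists_family_of_central_trivial_character (w : PlacesOver E v) (h3 : 3 ≤ N)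
    (μ : LemD1.MuSet (LemD1OfPlace.standingData E v c N J hcδ hδ hN hJh hJdet))
    (e : LemD1.EpsRep (LemD1OfPlace.standingData E v c N J hcδ hδ hN hJh hJdet))
    (Ψ : (LemD1OfPlace.standingData E v c N J hcδ hδ hN hJh hJdet).U →* ℂˣ)
    (hcen : ∀ z : (LemD1OfPlace.standingData E v c N J hcδ hδ hN hJh hJdet).normOne,
      Ψ ((LemD1OfPlace.standingData E v c N J hcδ hδ hN hJh hJdet).scalar z) = 1)
    (hopen : ∃ O : Set (LemD1OfPlace.standingData E v c N J hcδ hδ hN hJh hJdet).U, IsOpen O ∧ 1 ∈ O ∧ ∀ g ∈ O, Ψ g = 1)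
    (hne : ∃ g₀ : (LemD1OfPlace.standingData E v c N J hcδ hδ hN hJh hJdet).U, Ψ g₀ ≠ 1) :
    ∃ Lf : LemD1IndexedFamily (v.adicCompletion F) (LocalRing E v) N (Fin 2),
      Lf.S = LemD1OfPlace.standingData E v c N J hcδ hδ hN hJh hJdet ∧
      (∀ i, (Lf.eps i).1 = e.1) ∧ (∀ i, (Lf.chi i).1 = 1) ∧ (Lf.mu 0).1 = μ.1 ∧
      (Lf.mu 1).1 (LemD1OfPlace.eps E v hδ) = -μ.1 (LemD1OfPlace.eps E v hδ) ∧
      Lf.Item1AsPrinted ∧ LemD1_3AsPrintedI Lf ∧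
      Lf.mu 0 ≠ Lf.mu 1 ∧ LemD1.SameClass (Lf.eps 0) (Lf.eps 1) ∧ Lf.chi 0 = Lf.chi 1 ∧
      ¬ AreIsomorphicRep (Lf.quot 1) (Lf.quot 0) := by
  classical
  obtain ⟨e₁, he₁⟩ := e
  have hN2 : N ≠ 2 := by omega
  obtain ⟨μ₁, hneμ, hμ₁, -⟩ := LemD1IndexedNonVacuityLevelTwist.exists_muSet_ne_twist E v c hcδ hδ N J hN hJh hJdet w μ
  obtain ⟨g₀, hΨg₀⟩ := hne
  let S := LemD1OfPlace.standingData E v c N J hcδ hδ hN hJh hJdet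
  let χ₀ : LemD1.ChiSet S := ⟨1, fun z => by simp, by simpa using continuous_const⟩
  let ω₀ : Representation ℂ S.U ℂ := Representation.trivial ℂ S.U ℂ
  let ω₁ : Representation ℂ S.U ℂ := (DistribMulAction.toModuleEnd ℂ ℂ).comp Ψ
  have hω₀ : ∀ (g : S.U) (x : ℂ), ω₀ g x = ((1 : S.U →* ℂˣ) g : ℂ) * x := fun g x => by
    rw [MonoidHom.one_apply, Units.val_one, one_mul]; rfl
  have hω₁ : ∀ (g : S.U) (x : ℂ), ω₁ g x = (Ψ g : ℂ) * x := fun g x => by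
    change (Ψ g : ℂˣ) • x = _
    rw [Units.smul_def, smul_eq_mul]
  have hcen' : ∀ z : S.normOne, Ψ (S.scalar z) = χ₀.1 z := fun z => by
    rw [hcen z]; rfl
  let Lf : LemD1IndexedFamily (v.adicCompletion F) (LocalRing E v) N (Fin 2) :=
    { isNonarchimedeanLocalField := inferInstance
      isModuleTopology := LemD1OfPlace.isModuleTopology_localRing E v
      S := S
      mu := ![μ, μ₁]
      eps := fun _ => ⟨e₁, he₁⟩
      chi := fun _ => χ₀
      V := fun _ => ℂ
      omega := ![ω₀, ω₁] }
  have hμne : Lf.mu 0 ≠ Lf.mu 1 := fun h => hneμ h.symm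
  have hN₁ : augmentation (Lf.single 1).omega (Lf.single 1).S.scalar (Lf.single 1).chi = ⊥ :=
    augmentation_eq_bot_of_character (Lf.single 1) Ψ hω₁ hcen'
  have hg₀ : Ψ g₀ ≠ (1 : S.U →* ℂˣ) g₀ := by rwa [MonoidHom.one_apply]
  have hnotiso : ¬ AreIsomorphicRep (Lf.quot 1) (Lf.quot 0) :=
    not_areIsomorphicRep_quotRep_of_characters ω₁ ω₀ S.scalar_mem_center χ₀.1 χ₀.1 Ψ 1 hω₁ hω₀ hN₁ hg₀
  have hItem1 : Lf.Item1AsPrinted := by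
    intro i
    fin_cases i
    · exact lemD1_1AsPrinted_of_character_of_rank_ne_two' (Lf.single 0) 1 hω₀ (fun z => rfl)
        ⟨Set.univ, isOpen_univ, Set.mem_univ _, fun g _ => rfl⟩ hN2
    · exact lemD1_1AsPrinted_of_character_of_rank_ne_two' (Lf.single 1) Ψ hω₁ hcen' hopen hN2
  have hrefl : ∀ k : Fin 2, (AreIsomorphicRep (Lf.quot k) (Lf.quot k) ↔
      (Lf.mu k = Lf.mu k ∧ LemD1.SameClass (Lf.eps k) (Lf.eps k) ∧ Lf.chi k = Lf.chi k)) :=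
    fun k => iff_of_true ⟨LinearEquiv.refl ℂ _, fun _ _ => rfl⟩ ⟨rfl, ⟨1, by simp⟩, rfl⟩
  have hItem3 : LemD1_3AsPrintedI Lf := by
    intro _ i j
    fin_cases i <;> fin_cases j
    · exact hrefl 0
    · exact iff_of_false hnotiso fun h => hμne h.1.symm
    · exact iff_of_false (fun h => hnotiso h.symm) fun h => hμne h.1
    · exact hrefl 1
  have hsame : LemD1.SameClass (Lf.eps 0) (Lf.eps 1) := hrefl 0 |>.mp ⟨LinearEquiv.refl ℂ _, fun _ _ => rfl⟩ |>.2.1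
  exact ⟨Lf, rfl, fun _ => rfl, fun _ => rfl, rfl, hμ₁, hItem1, hItem3, hμne, hsame, rfl, hnotiso⟩

include hcδ in
/-- **(1) ∧ (3) JOINTLY with the `μ`-CONJUNCT ALONE SEPARATING — at a NON-SPLIT place from ANY global norm-one unit `ζ`** with
`v_w(ζ − 1) ≠ 0`, `v_w(ζ^N − 1) < v_w(ζ − 1)` (`N ≥ 3`; any quadratic `E/F`): for every `μ ∈ MuSet S` and every representative `e`, the
two-member collection with labels `(μ, e, 1)`, `(μ', e, 1)` and carriers the trivial line and the line of the carrier character of §1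
satisfies [Lem. D.1, first sentence + (1)] AS PRINTED member by member AND [Lem. D.1 (3)] AS PRINTED for all four pairs; exactly the
`μ`-conjunct fails and the `ω`'s are non-isomorphic with EQUAL central characters. [cite: Liu2021, App. D Lemma D.1 (1) and (3) (l. 5229, 5233)] -/
theorem exists_lemD1IndexedFamily_item1_and_lemD1_3_mu_of_norm_one (w : PlacesOver E v) (hw : c • w.1 = w.1) (ζ : E)
    (hζc : ζ * c ζ = 1) (hζ0 : w.1.valuation E (ζ - 1) ≠ 0) (hζN : w.1.valuation E (ζ ^ N - 1) < w.1.valuation E (ζ - 1))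
    (h3 : 3 ≤ N) (μ : LemD1.MuSet (LemD1OfPlace.standingData E v c N J hcδ hδ hN hJh hJdet))
    (e : LemD1.EpsRep (LemD1OfPlace.standingData E v c N J hcδ hδ hN hJh hJdet)) :
    ∃ Lf : LemD1IndexedFamily (v.adicCompletion F) (LocalRing E v) N (Fin 2),
      Lf.S = LemD1OfPlace.standingData E v c N J hcδ hδ hN hJh hJdet ∧
      (∀ i, (Lf.eps i).1 = e.1) ∧ (∀ i, (Lf.chi i).1 = 1) ∧ (Lf.mu 0).1 = μ.1 ∧
      (Lf.mu 1).1 (LemD1OfPlace.eps E v hδ) = -μ.1 (LemD1OfPlace.eps E v hδ) ∧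
      Lf.Item1AsPrinted ∧ LemD1_3AsPrintedI Lf ∧
      Lf.mu 0 ≠ Lf.mu 1 ∧ LemD1.SameClass (Lf.eps 0) (Lf.eps 1) ∧ Lf.chi 0 = Lf.chi 1 ∧
      ¬ AreIsomorphicRep (Lf.quot 1) (Lf.quot 0) := by
  obtain ⟨Ψ, hcen, hopen, hne, -, -⟩ :=
    exists_carrier_character_of_norm_one E v c hcδ hδ N J hN hJh hJdet w hw ζ hζc hζ0 hζN
  exact exists_family_of_central_trivial_character E v c hcδ hδ N J hN hJh hJdet w h3 μ e Ψ hcen hopen hne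

include hcδ in
/-- **(1) ∧ (3) JOINTLY with the `μ`-CONJUNCT ALONE SEPARATING — at an INERT place with `gcd(N, q_v + 1) > 1`** (`v` unramified in
`E`, `c • w = w`, `N ≥ 3` not coprime to `q_v + 1`; ANY quadratic `E/F`, no torsion, no `w ∣ N`): labels `(μ, e, 1)`, `(μ', e, 1)`,
carriers the trivial line and the line of the inert carrier character of §2. [cite: Liu2021, App. D Lemma D.1 (1) and (3) (l. 5229, 5233)] -/
theorem exists_lemD1IndexedFamily_item1_and_lemD1_3_mu_of_inert (hv : Algebra.IsUnramifiedIn (𝓞 E) v.asIdeal)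
    (w : PlacesOver E v) (hw : c • w.1 = w.1) (hNq : ¬ Nat.Coprime N (Nat.card (𝓞 F ⧸ v.asIdeal) + 1)) (h3 : 3 ≤ N)
    (μ : LemD1.MuSet (LemD1OfPlace.standingData E v c N J hcδ hδ hN hJh hJdet))
    (e : LemD1.EpsRep (LemD1OfPlace.standingData E v c N J hcδ hδ hN hJh hJdet)) :
    ∃ Lf : LemD1IndexedFamily (v.adicCompletion F) (LocalRing E v) N (Fin 2),
      Lf.S = LemD1OfPlace.standingData E v c N J hcδ hδ hN hJh hJdet ∧
      (∀ i, (Lf.eps i).1 = e.1) ∧ (∀ i, (Lf.chi i).1 = 1) ∧ (Lf.mu 0).1 = μ.1 ∧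
      (Lf.mu 1).1 (LemD1OfPlace.eps E v hδ) = -μ.1 (LemD1OfPlace.eps E v hδ) ∧
      Lf.Item1AsPrinted ∧ LemD1_3AsPrintedI Lf ∧
      Lf.mu 0 ≠ Lf.mu 1 ∧ LemD1.SameClass (Lf.eps 0) (Lf.eps 1) ∧ Lf.chi 0 = Lf.chi 1 ∧
      ¬ AreIsomorphicRep (Lf.quot 1) (Lf.quot 0) := by
  obtain ⟨Ψ, hcen, hopen, hne, -, -⟩ := exists_inert_carrier_character E v c hcδ hδ N J hN hJh hJdet hv w hw hNq
  exact exists_family_of_central_trivial_character E v c hcδ hδ N J hN hJh hJdet w h3 μ e Ψ hcen hopen hne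

include hcδ in
/-- **Consequence — INERT places with `gcd(N, q_v + 1) > 1`, every `N ≥ 3`, NO hypothesis on `μ`** (the Step-2 index set is non-empty at
every place, ✔ `…NormClassExtensionDyadic.nonempty_muSet`): the records (1) ∧ (3) read on an indexed collection over the place model do NOT
by their shape force «same `ε`-class ∧ same `χ` ⟹ same `μ`». [cite: Liu2021, App. D Lemma D.1 (1) and (3) (l. 5229, 5233)] -/
theorem not_forall_mu_eq_of_sameClass_of_chi_eq_of_inert (hv : Algebra.IsUnramifiedIn (𝓞 E) v.asIdeal) (w : PlacesOver E v)
    (hw : c • w.1 = w.1) (hNq : ¬ Nat.Coprime N (Nat.card (𝓞 F ⧸ v.asIdeal) + 1)) (h3 : 3 ≤ N) :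
    ¬ ∀ Lf : LemD1IndexedFamily (v.adicCompletion F) (LocalRing E v) N (Fin 2),
        Lf.S = LemD1OfPlace.standingData E v c N J hcδ hδ hN hJh hJdet →
        Lf.Item1AsPrinted → LemD1_3AsPrintedI Lf →
        ∀ i j : Fin 2, LemD1.SameClass (Lf.eps i) (Lf.eps j) → Lf.chi i = Lf.chi j → Lf.mu i = Lf.mu j := by
  obtain ⟨μ⟩ := LemD1IndexedNonVacuityNormClassExtensionDyadic.nonempty_muSet E v c hcδ hδ N J hN hJh hJdet
  intro h
  obtain ⟨Lf, hS, -, -, -, -, h1, h3', hne, hsame, hchi, -⟩ :=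
    exists_lemD1IndexedFamily_item1_and_lemD1_3_mu_of_inert E v c hcδ hδ N J hN hJh hJdet hv w hw hNq h3 μ
      (LemD1OfPlace.epsDelta E v c N J hcδ hδ hN hJh hJdet)
  exact hne (h Lf hS h1 h3' 0 1 hsame hchi)

include hcδ in
/-- **… nor «same Step-3 character `χ` ⟹ isomorphic `ω`'s»** — inert places with `gcd(N, q_v + 1) > 1`, every `N ≥ 3`.
[cite: Liu2021, App. D Lemma D.1 (1) and (3) (l. 5229, 5233)] -/
theorem not_forall_areIsomorphicRep_of_chi_eq_of_inert (hv : Algebra.IsUnramifiedIn (𝓞 E) v.asIdeal) (w : PlacesOver E v)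
    (hw : c • w.1 = w.1) (hNq : ¬ Nat.Coprime N (Nat.card (𝓞 F ⧸ v.asIdeal) + 1)) (h3 : 3 ≤ N) :
    ¬ ∀ Lf : LemD1IndexedFamily (v.adicCompletion F) (LocalRing E v) N (Fin 2),
        Lf.S = LemD1OfPlace.standingData E v c N J hcδ hδ hN hJh hJdet →
        Lf.Item1AsPrinted → LemD1_3AsPrintedI Lf →
        ∀ i j : Fin 2, Lf.chi i = Lf.chi j → AreIsomorphicRep (Lf.quot j) (Lf.quot i) := by
  obtain ⟨μ⟩ := LemD1IndexedNonVacuityNormClassExtensionDyadic.nonempty_muSet E v c hcδ hδ N J hN hJh hJdet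
  intro h
  obtain ⟨Lf, hS, -, -, -, -, h1, h3', -, -, hchi, hnot⟩ :=
    exists_lemD1IndexedFamily_item1_and_lemD1_3_mu_of_inert E v c hcδ hδ N J hN hJh hJdet hv w hw hNq h3 μ
      (LemD1OfPlace.epsDelta E v c N J hcδ hδ hN hJh hJdet)
  exact hnot (h Lf hS h1 h3' 0 1 hchi)

end PlaceModel

/-! ## §4 The CM rows at the INERT places `v` of `L⁺` with `gcd(N, q_v + 1) > 1` (for the END: `q_v ≡ 2 (mod 3)`) -/

section CM

open Literature.NumberTheory.GelbartRogawski1991.UnitaryDualPair (imagUnit complexConj_imagUnit imagUnit_ne_zero)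
open Literature.NumberTheory.GelbartRogawski1991.UnitaryDualPair.LocalSplitting (localMu norm_localMu continuous_localMu
  localMu_toLocalRing_eq_one_iff)
open Literature.NumberTheory.Automorphic.IdeleClassGroup (toHeckeCharacter isUnitary_toHeckeCharacter IsConjugateSymplectic)
open Literature.RepresentationTheory.Liu2021 (isOscillatorChar_toHeckeCharacter_iff)

variable (L : Type) [Field L] [NumberField L] [IsCMField L]

local notation3 "cc" => (IsCMField.complexConj L)
local notation3 "L⁺" => (↥(maximalRealSubfield L))

variable (v : HeightOneSpectrum (𝓞 (maximalRealSubfield L))) (N : ℕ) (J : Matrix (Fin N) (Fin N) L) (hN : 2 ≤ N)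
  (hJh : (J.map (IsCMField.complexConj L))ᵀ = J) (hJdet : J.det ≠ 0)

/-- **the `μ`-alone certificate with the rows' OWN `μ_v` as member `0` — at every INERT place `w ∣ v` of `L` (`v` unramified in `L`,
`\bar w = w`) with `gcd(N, q_v + 1) > 1`** (ANY CM field, no root of unity, `v ∤ N` allowed), every `N ≥ 3`, every conjugate symplectic `ψ`.
[cite: Liu2021, App. D Lemma D.1 (1) and (3) (l. 5229, 5233); Def. 4.11 (l. 2086)] -/
theorem exists_lemD1IndexedFamily_item1_and_lemD1_3_localMu_mu_of_inert (hv : Algebra.IsUnramifiedIn (𝓞 L) v.asIdeal)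
    (w : PlacesOver L v) (hw : cc • w.1 = w.1)
    (hNq : ¬ Nat.Coprime N (Nat.card (𝓞 L⁺ ⧸ v.asIdeal) + 1)) (h3 : 3 ≤ N)
    (ψ : IdeleClassGroup L →ₜ* Circle) (hψ : IsConjugateSymplectic L ψ) :
    ∃ Lf : LemD1IndexedFamily (v.adicCompletion L⁺) (LocalRing L v) N (Fin 2),
      Lf.S = LemD1OfPlace.standingData L v cc N J (complexConj_imagUnit L) (imagUnit_ne_zero L) hN hJh hJdet ∧
      (∀ i, (Lf.eps i).1 = LemD1OfPlace.eps L v (imagUnit_ne_zero L)) ∧ (∀ i, (Lf.chi i).1 = 1) ∧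
      (Lf.mu 0).1 = localMu L (toHeckeCharacter L ψ) v ∧
      (Lf.mu 1).1 (LemD1OfPlace.eps L v (imagUnit_ne_zero L)) =
        -localMu L (toHeckeCharacter L ψ) v (LemD1OfPlace.eps L v (imagUnit_ne_zero L)) ∧
      Lf.Item1AsPrinted ∧ LemD1_3AsPrintedI Lf ∧
      Lf.mu 0 ≠ Lf.mu 1 ∧ LemD1.SameClass (Lf.eps 0) (Lf.eps 1) ∧ Lf.chi 0 = Lf.chi 1 ∧
      ¬ AreIsomorphicRep (Lf.quot 1) (Lf.quot 0) :=
  exists_lemD1IndexedFamily_item1_and_lemD1_3_mu_of_inert L v cc (complexConj_imagUnit L) (imagUnit_ne_zero L) N J hN hJh hJdet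
    hv w hw hNq h3
    (LemD1OfPlace.muOf L v cc N J (complexConj_imagUnit L) (imagUnit_ne_zero L) hN hJh hJdet
      (localMu L (toHeckeCharacter L ψ) v)
      (fun x => norm_localMu L (toHeckeCharacter L ψ) v (isUnitary_toHeckeCharacter L ψ) x)
      (continuous_localMu L (toHeckeCharacter L ψ) v)
      (fun t => localMu_toLocalRing_eq_one_iff L (toHeckeCharacter L ψ) v
        ((isOscillatorChar_toHeckeCharacter_iff ψ).mpr hψ) t))
    (LemD1OfPlace.epsDelta L v cc N J (complexConj_imagUnit L) (imagUnit_ne_zero L) hN hJh hJdet)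

/-- **the records `hD1''` ∕ `hD3` read at the rows' slot types do not force «same `ε`-class and same `χ` ⟹ same `μ`»** — ANY CM field,
every INERT place with `gcd(N, q_v + 1) > 1`, every `N ≥ 3`. [cite: Liu2021, App. D Lemma D.1 (1) and (3) (l. 5229, 5233)] -/
theorem not_forall_mu_eq_of_sameClass_of_chi_eq_of_isCMField_of_inert (hv : Algebra.IsUnramifiedIn (𝓞 L) v.asIdeal)
    (w : PlacesOver L v) (hw : cc • w.1 = w.1) (hNq : ¬ Nat.Coprime N (Nat.card (𝓞 L⁺ ⧸ v.asIdeal) + 1)) (h3 : 3 ≤ N) :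
    ¬ ∀ Lf : LemD1IndexedFamily (v.adicCompletion L⁺) (LocalRing L v) N (Fin 2),
        Lf.S = LemD1OfPlace.standingData L v cc N J (complexConj_imagUnit L) (imagUnit_ne_zero L) hN hJh hJdet →
        Lf.Item1AsPrinted → LemD1_3AsPrintedI Lf →
        ∀ i j : Fin 2, LemD1.SameClass (Lf.eps i) (Lf.eps j) → Lf.chi i = Lf.chi j → Lf.mu i = Lf.mu j :=
  not_forall_mu_eq_of_sameClass_of_chi_eq_of_inert L v cc (complexConj_imagUnit L) (imagUnit_ne_zero L) N J hN hJh hJdet hv w hw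
    hNq h3

/-- **… nor «same central character ⟹ isomorphic carriers»** (same hypotheses). [cite: Liu2021, App. D Lemma D.1 (1) and (3) (l. 5229, 5233)] -/
theorem not_forall_areIsomorphicRep_of_chi_eq_of_isCMField_of_inert (hv : Algebra.IsUnramifiedIn (𝓞 L) v.asIdeal)
    (w : PlacesOver L v) (hw : cc • w.1 = w.1) (hNq : ¬ Nat.Coprime N (Nat.card (𝓞 L⁺ ⧸ v.asIdeal) + 1)) (h3 : 3 ≤ N) :
    ¬ ∀ Lf : LemD1IndexedFamily (v.adicCompletion L⁺) (LocalRing L v) N (Fin 2),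
        Lf.S = LemD1OfPlace.standingData L v cc N J (complexConj_imagUnit L) (imagUnit_ne_zero L) hN hJh hJdet →
        Lf.Item1AsPrinted → LemD1_3AsPrintedI Lf →
        ∀ i j : Fin 2, Lf.chi i = Lf.chi j → AreIsomorphicRep (Lf.quot j) (Lf.quot i) :=
  not_forall_areIsomorphicRep_of_chi_eq_of_inert L v cc (complexConj_imagUnit L) (imagUnit_ne_zero L) N J hN hJh hJdet hv w hw hNq h3

/-- `3 ∣ N` and `3 ∣ q + 1` give `¬ Coprime N (q + 1)`. [folklore] -/
private theorem not_coprime_of_three_dvd {N q : ℕ} (h3N : 3 ∣ N) (h3q : 3 ∣ q + 1) : ¬ Nat.Coprime N (q + 1) :=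
  Nat.not_coprime_of_dvd_of_dvd (by norm_num) h3N h3q

/-- **THE END's CASE `3 ∣ N` (rank `3`): ANY CM field `L`, at EVERY INERT place `w ∣ v` of `L` (`v` unramified in `L`) with
`q_v ≡ 2 (mod 3)`, i.e. `3 ∣ q_v + 1`** — the records `hD1''` ∕ `hD3` do not force «same `ε`-class ∧ same `χ` ⟹ same `μ`»; no `ζ_3 ∈ L`,
no `v ∣ 3` needed. [cite: Liu2021, App. D Lemma D.1 (1) and (3) (l. 5229, 5233)] -/
theorem not_forall_mu_eq_of_sameClass_of_chi_eq_of_isCMField_of_three_dvd (hv : Algebra.IsUnramifiedIn (𝓞 L) v.asIdeal)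
    (w : PlacesOver L v) (hw : cc • w.1 = w.1) (h3N : 3 ∣ N) (h3q : 3 ∣ Nat.card (𝓞 L⁺ ⧸ v.asIdeal) + 1) (h3 : 3 ≤ N) :
    ¬ ∀ Lf : LemD1IndexedFamily (v.adicCompletion L⁺) (LocalRing L v) N (Fin 2),
        Lf.S = LemD1OfPlace.standingData L v cc N J (complexConj_imagUnit L) (imagUnit_ne_zero L) hN hJh hJdet →
        Lf.Item1AsPrinted → LemD1_3AsPrintedI Lf →
        ∀ i j : Fin 2, LemD1.SameClass (Lf.eps i) (Lf.eps j) → Lf.chi i = Lf.chi j → Lf.mu i = Lf.mu j :=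
  not_forall_mu_eq_of_sameClass_of_chi_eq_of_isCMField_of_inert L v N J hN hJh hJdet hv w hw (not_coprime_of_three_dvd h3N h3q) h3

/-- **… nor «same central character ⟹ isomorphic carriers»**, same hypotheses (`3 ∣ N`, inert `v` with `3 ∣ q_v + 1`).
[cite: Liu2021, App. D Lemma D.1 (1) and (3) (l. 5229, 5233)] -/
theorem not_forall_areIsomorphicRep_of_chi_eq_of_isCMField_of_three_dvd (hv : Algebra.IsUnramifiedIn (𝓞 L) v.asIdeal)
    (w : PlacesOver L v) (hw : cc • w.1 = w.1) (h3N : 3 ∣ N) (h3q : 3 ∣ Nat.card (𝓞 L⁺ ⧸ v.asIdeal) + 1) (h3 : 3 ≤ N) :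
    ¬ ∀ Lf : LemD1IndexedFamily (v.adicCompletion L⁺) (LocalRing L v) N (Fin 2),
        Lf.S = LemD1OfPlace.standingData L v cc N J (complexConj_imagUnit L) (imagUnit_ne_zero L) hN hJh hJdet →
        Lf.Item1AsPrinted → LemD1_3AsPrintedI Lf →
        ∀ i j : Fin 2, Lf.chi i = Lf.chi j → AreIsomorphicRep (Lf.quot j) (Lf.quot i) :=
  not_forall_areIsomorphicRep_of_chi_eq_of_isCMField_of_inert L v N J hN hJh hJdet hv w hw (not_coprime_of_three_dvd h3N h3q) h3

end CM

end Literature.NumberTheory.Automorphic.Liu2021.LemD1IndexedNonVacuityInertCarrier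

end
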